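import Literature.Geometry.GeometricMeasureTheory.CutAndPaste
import Literature.Geometry.GeometricMeasureTheory.CurrentsSupportTheorem
import Literature.Geometry.GeometricMeasureTheory.HausdorffDensity
import Mathlib.MeasureTheory.Integral.Prod
import Mathlib.MeasureTheory.Group.Integral
import Mathlib.MeasureTheory.Measure.RegularityCompacts
import Mathlib.Analysis.Distribution.AEEqOfIntegralContDiff
import HarnessLib

/-!
# Normal currents do not charge `𝓗ᵐ`-null sets (Federer 4.1.20–4.1.21 for `𝐍_m`)

For a **normal** current `T` (`𝐌(T) + 𝐌(∂T) < ∞`, compact support) of dimension `m + 1` in a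
finite-dimensional real normed space `V` and a set `E ⊆ V` with `𝓗^{m+1}(E) = 0` we prove
`‖T‖(E) = 0`, i.e. `‖T‖ ≪ 𝓗^{m+1}` [Federer1969, 4.1.20 with 4.1.21: "If `T ∈ 𝐅_m(U)`, `m > 0`,
`𝐌(T) < ∞` and `E ⊂ U`, then `𝓘₁^m(E) = 0` implies `‖T‖(E) = 0`"; here for normal currents and with
`𝓗^m` in place of the integralgeometric measure]. Consequently the upper density
`Θ^{*(m+1)}(‖T‖, ·)` is finite `‖T‖`-almost everywhere. This is the measure-theoretic input of the
blow-up analysis in B. White's proof of the closure theorem [White1989, p. 212: "`μ_T ≪ 𝓗ⁿ ⌞ M`"].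

Federer's proof (4.1.20) expands a test form as `φ = Σ_λ φ_λ ∧ 𝐩_λ^♯(DY₁ ∧ ⋯ ∧ DY_{m+1})` and observes
that `𝐩_λ#(T ⌞ φ_λ)` is a top-dimensional flat chain of `ℝ^{m+1}` supported in the Lebesgue-null
set `𝐩_λ(E)`, hence zero by 4.1.18 (`𝐅_{m+1}(ℝ^{m+1}) = L¹`). We follow this, replacing 4.1.18 by
an explicit **absolute-continuity estimate for top-degree pull-back forms**: for a normal `X`, a
linear `P : V → ℝ^{m+1}` with a right inverse `Q`, a cutoff `ψ = 1` near `spt X`, and a smooth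
`e : ℝ^{m+1} → [0, 1]`,
  `ℒ(B_ε) |X((e ∘ P) ψ · P^♯DY)| ≤ ‖P^♯DY‖ (𝐌(X) ‖e‖_{L¹} + ℒ(B_ε) ‖Q‖ ε 𝐌(∂X))`.
Indeed, translating by `w = Q u` changes `X((e∘P)ψ · P^♯DY)` by at most `‖w‖ ‖P^♯DY‖ 𝐌(∂X)` — the
homotopy formula [Federer1969, 4.1.9] for the affine homotopy from `id` to `· + w`, in which the
term `∂h_#([0,1] × X)` does not contribute because the top-degree form `(e∘P) · P^♯DY` is closed near
the homotopy — while the average over `u ∈ B_ε` of the translated values is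
`∫ (∫_{B_ε} e(Px + u) du) ψ ⟨P^♯DY, X⃗⟩ d‖X‖ ≤ ‖e‖_{L¹} ‖P^♯DY‖ 𝐌(X)` (polar representation and
Fubini). Letting `e ↓ 1_A` for a compact Lebesgue-null `A ⊆ ℝ^{m+1}` and then `ε → 0` gives
`∫ 1_A(Px) ψ' ⟨P^♯DY, X⃗⟩ d‖X‖ = 0` for every test function `ψ'` (applied to `X ⌞ ψ'`), so
`1_{P⁻¹A} ⟨P^♯DY, X⃗⟩ = 0` `‖X‖`-a.e.; with `A = 𝐩_λ(K)` for compact `K ⊆ E` this kills every term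
of `(T ⌞ K)(φ)`.

Main statements:
* `Current.abs_apply_pullbackDet_sub_translate_le` — the translation estimate;
* `Current.volume_mul_abs_integral_pullbackDet_le` — the absolute-continuity estimate;
* `Current.ae_indicator_preimage_mul_polar_eq_zero` — `1_{P⁻¹A} ⟨P^♯DY, X⃗⟩ = 0` a.e. for
  Lebesgue-null compact `A`;
* **`Current.variation_eq_zero_of_hausdorffMeasure_eq_zero`** — `𝓗^{m+1}(E) = 0 ⇒ ‖T‖(E) = 0` for
  normal `T` with compact support; `Current.variation_absolutelyContinuous_hausdorffMeasure`;
* `Current.ae_upperDensity_lt_top` — `Θ^{*(m+1)}(‖T‖, x) < ∞` for `‖T‖`-a.e. `x`.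

Theorems only; no definitions, no named facts.

## References

* H. Federer, *Geometric Measure Theory*, Springer 1969, 4.1.9, 4.1.18, 4.1.20, 4.1.21, 2.10.19 (3)
  (held copy `lit book:federernd-geometric-measure-theory`, PDF pp. 319–320) [Federer1969].
* B. White, *A new proof of the compactness theorem for integral currents*, Comment. Math. Helv.
  64 (1989) 207–220, p. 212 [White1989].
-/

noncomputable section

open scoped ENNReal NNReal Topology Distributions ContDiff
open MeasureTheory TopologicalSpace Set Filter Metric Function

namespace Literature.Geometry.GeometricMeasureTheory

set_option maxSynthPendingDepth 2

variable {V : Type*} [NormedAddCommGroup V] [InnerProductSpace ℝ V] [FiniteDimensional ℝ V]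
  [MeasurableSpace V] [BorelSpace V] {m : ℕ}

/-! ### Top-degree pull-back forms are closed where the scalar factor is locally constant -/

section Forms

omit [FiniteDimensional ℝ V] [MeasurableSpace V] [BorelSpace V] in
/-- `d(ψ • c)(x) = 0` at a point where `Dψ(x) = 0`. [folklore] -/
private theorem extDerivCLM_smulCovectorCLM_eq_zero_of_fderiv {k : ℕ} (c : Covector V k)
    (ψ : 𝓓((⊤ : Opens V), ℝ)) {x : V} (hx : fderiv ℝ ψ x = 0) :
    TestForm.extDerivCLM (smulCovectorCLM c ψ) x = 0 := by
  rw [extDerivCLM_smulCovectorCLM_apply, hx, ContinuousLinearMap.zero_smulRight,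
    ← ContinuousAlternatingMap.alternatizeUncurryFinCLM_apply, map_zero]

omit [FiniteDimensional ℝ V] [MeasurableSpace V] [BorelSpace V] in
/-- The top-degree form `(e ∘ P) ψ • P^♯(DY)` is closed at every point where `Dψ = 0`
(the `De`-term is a `(k+1)`-form pulled back from `ℝᵏ`). [cite: Federer1969, 4.1.20 (proof)] -/
theorem extDerivCLM_pullbackDet_testFunctionMulComp_eq_zero {k : ℕ} (ψ : 𝓓((⊤ : Opens V), ℝ))
    (e : (Fin k → ℝ) → ℝ) (he : ContDiff ℝ (⊤ : ℕ∞) e) (P : V →L[ℝ] (Fin k → ℝ)) {x : V}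
    (hx : fderiv ℝ ψ x = 0) :
    TestForm.extDerivCLM (smulCovectorCLM (pullbackDet P) (testFunctionMulComp ψ e he P)) x = 0 := by
  rw [extDerivCLM_smulCovectorCLM_testFunctionMulComp,
    extDerivCLM_smulCovectorCLM_eq_zero_of_fderiv _ ψ hx, smul_zero]

omit [FiniteDimensional ℝ V] [MeasurableSpace V] [BorelSpace V] in
/-- A test function equal to `1` on an open set has vanishing differential there. [folklore] -/
private theorem fderiv_eq_zero_of_eqOn_one (ψ : 𝓓((⊤ : Opens V), ℝ)) {U : Set V} (hU : IsOpen U)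
    (hψ : ∀ x ∈ U, ψ x = 1) {x : V} (hx : x ∈ U) : fderiv ℝ ψ x = 0 := by
  have h : (ψ : V → ℝ) =ᶠ[𝓝 x] fun _ => (1 : ℝ) :=
    Filter.eventually_of_mem (hU.mem_nhds hx) fun y hy => hψ y hy
  rw [h.fderiv_eq, fderiv_const_apply]

omit [MeasurableSpace V] [BorelSpace V] in
/-- Two test forms agreeing on an open set containing `spt T` have the same value on `T`.
[cite: Federer1969, 4.1.1] -/
theorem Current.apply_eq_of_eqOn_nhds_support {k : ℕ} (T : Current (⊤ : Opens V) k) {U : Set V}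
    (hU : IsOpen U) (hTU : T.support ⊆ U) {φ φ' : TestForm (⊤ : Opens V) k}
    (h : ∀ x ∈ U, φ x = φ' x) : T φ = T φ' := by
  rw [← sub_eq_zero, ← map_sub]
  refine T.apply_eq_zero_of_disjoint_support (Set.disjoint_left.2 fun x hx hxT => ?_)
  have h0 : (fun y => (φ - φ') y) =ᶠ[𝓝 x] 0 :=
    Filter.eventually_of_mem (hU.mem_nhds (hTU hxT)) fun y hy => by
      show φ y - φ' y = 0
      rw [h y hy, sub_self]
  exact (notMem_tsupport_iff_eventuallyEq.2 h0) hx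

end Forms

/-! ### The translation estimate -/

section Translate

omit [FiniteDimensional ℝ V] [MeasurableSpace V] [BorelSpace V] in
/-- `spt (T ⌞ g) ⊆ spt T`. [cite: Federer1969, 4.1.7] -/
theorem Current.support_smulFun_subset {k : ℕ} (T : Current (⊤ : Opens V) k) {g : V → ℝ}
    (hg : ContDiff ℝ ∞ g) : (T.smulFun hg).support ⊆ T.support := by
  intro x hx
  by_contra hxT
  obtain ⟨O, hO, hTO⟩ := T.exists_nhds_of_not_mem_support (mem_univ x) hxT
  obtain ⟨φ, hφ, hne⟩ := hx.2 O hO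
  refine hne ?_
  rw [Current.smulFun_apply]
  exact hTO _ ((TestForm.tsupport_smulFun_subset hg φ).trans hφ)

omit [FiniteDimensional ℝ V] [MeasurableSpace V] [BorelSpace V] in
/-- `𝐌(T ⌞ g) ≤ C 𝐌(T)` when `|g| ≤ C`. [cite: Federer1969, 4.1.7] -/
theorem Current.mass_smulFun_le {k : ℕ} (T : Current (⊤ : Opens V) k) {g : V → ℝ}
    (hg : ContDiff ℝ ∞ g) {C : ℝ} (hC : 0 < C) (hgC : ∀ x, |g x| ≤ C) :
    (T.smulFun hg).mass ≤ ENNReal.ofReal C * T.mass := by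
  refine iSup₂_le fun φ hφ => ?_
  rw [Current.smulFun_apply]
  refine (ENNReal.ofReal_le_ofReal (le_abs_self _)).trans
    (T.ofReal_abs_apply_le_mul_mass hC fun x => ?_)
  rw [TestForm.smulFun_apply, norm_smul, Real.norm_eq_abs]
  exact (mul_le_mul (hgC x) (hφ x) (norm_nonneg _) hC.le).trans (mul_one C).le

omit [FiniteDimensional ℝ V] [MeasurableSpace V] [BorelSpace V] in
/-- `𝐌(T ⌞ dg) ≤ (k + 1) D 𝐌(T)` when `‖Dg‖ ≤ D`. [cite: Federer1969, 4.1.7] -/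
theorem Current.mass_wedgeD_le {k : ℕ} (T : Current (⊤ : Opens V) (k + 1)) {g : V → ℝ}
    (hg : ContDiff ℝ ∞ g) {D : ℝ} (hD : 0 < D) (hgD : ∀ x, ‖fderiv ℝ g x‖ ≤ D) :
    (T.wedgeD hg).mass ≤ ENNReal.ofReal ((k + 1) * D) * T.mass := by
  refine iSup₂_le fun φ hφ => ?_
  rw [Current.wedgeD_apply]
  refine (ENNReal.ofReal_le_ofReal (le_abs_self _)).trans
    (T.ofReal_abs_apply_le_mul_mass (by positivity) fun x => ?_)
  refine (TestForm.norm_wedgeD_apply_le hg φ x).trans ?_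
  calc ((k : ℝ) + 1) * ‖fderiv ℝ g x‖ * ‖φ x‖ ≤ ((k : ℝ) + 1) * D * 1 := by
        gcongr
        · exact hgD x
        · exact hφ x
    _ = (k + 1) * D := mul_one _

omit [FiniteDimensional ℝ V] [MeasurableSpace V] [BorelSpace V] in
/-- **`T ⌞ ψ` is normal when `T` is**: `𝐌(T ⌞ ψ) < ∞` and `𝐌(∂(T ⌞ ψ)) < ∞` for a test function `ψ`
(`∂(T ⌞ ψ) = (∂T) ⌞ ψ − T ⌞ dψ`). [cite: Federer1969, 4.1.7] -/
theorem Current.mass_smulFun_ne_top_and (T : Current (⊤ : Opens V) (m + 1))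
    (hT : T.mass ≠ ⊤) (hdT : T.boundary.mass ≠ ⊤) (ψ : 𝓓((⊤ : Opens V), ℝ)) :
    (T.smulFun ψ.contDiff).mass ≠ ⊤ ∧ (T.smulFun ψ.contDiff).boundary.mass ≠ ⊤ := by
  obtain ⟨C, hC⟩ := ψ.hasCompactSupport.exists_bound_of_continuous ψ.contDiff.continuous
  have hdc : Continuous fun x => fderiv ℝ ψ x := ψ.contDiff.continuous_fderiv (by simp)
  have hds : HasCompactSupport fun x => fderiv ℝ ψ x := ψ.hasCompactSupport.fderiv ℝ
  obtain ⟨D, hD⟩ := hds.exists_bound_of_continuous hdc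
  set C' := max C 1 with hC'
  set D' := max D 1 with hD'
  have hC'0 : 0 < C' := lt_max_of_lt_right one_pos
  have hD'0 : 0 < D' := lt_max_of_lt_right one_pos
  have hψC : ∀ x, |ψ x| ≤ C' := fun x => by
    have := hC x; rw [Real.norm_eq_abs] at this; exact this.trans (le_max_left _ _)
  have hψD : ∀ x, ‖fderiv ℝ ψ x‖ ≤ D' := fun x => (hD x).trans (le_max_left _ _)
  refine ⟨ne_top_of_le_ne_top (ENNReal.mul_ne_top ENNReal.ofReal_ne_top hT)
    (T.mass_smulFun_le ψ.contDiff hC'0 hψC), ?_⟩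
  rw [Current.boundary_smulFun]
  refine ne_top_of_le_ne_top ?_ (Current.mass_sub_le_add _ _)
  exact ENNReal.add_ne_top.2
    ⟨ne_top_of_le_ne_top (ENNReal.mul_ne_top ENNReal.ofReal_ne_top hdT)
      (T.boundary.mass_smulFun_le ψ.contDiff hC'0 hψC),
    ne_top_of_le_ne_top (ENNReal.mul_ne_top ENNReal.ofReal_ne_top hT)
      (T.mass_wedgeD_le ψ.contDiff hD'0 hψD)⟩

omit [MeasurableSpace V] [BorelSpace V] in
/-- **The translation estimate.** Let `X` be a current of dimension `m + 1` with `𝐌(∂X) < ∞`,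
`P : V → ℝ^{m+1}` linear, `e : ℝ^{m+1} → [−1, 1]` smooth, and `ψ` a test function equal to `1` on an
open set `U` containing every segment `[x, x + w]`, `x ∈ spt X`. Then translating `e` by `P w`
changes the value of `X` on the top-degree form `(e ∘ P) ψ • P^♯(DY₁∧⋯∧DY_{m+1})` by at most
`‖w‖ ‖P^♯DY‖ 𝐌(∂X)`: by the homotopy formula for the affine homotopy `h` from `id` to `· + w`
[Federer1969, 4.1.9], `(·+w)_# X − X = ∂h_#([0,1] × X) + h_#([0,1] × ∂X)`, the first term vanishes
on the form because it is closed on `U ⊇ spt h_#([0,1] × X)`, and the second has mass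
`≤ ‖w‖ 𝐌(∂X)`. [cite: Federer1969, 4.1.9, 4.1.20] -/
theorem Current.abs_apply_pullbackDet_sub_translate_le (X : Current (⊤ : Opens V) (m + 1))
    (hXc : IsCompact X.support) (hdX : X.boundary.mass ≠ ⊤) (P : V →L[ℝ] (Fin (m + 1) → ℝ))
    (e₁ e₂ : (Fin (m + 1) → ℝ) → ℝ) (he₁ : ContDiff ℝ (⊤ : ℕ∞) e₁) (he₂ : ContDiff ℝ (⊤ : ℕ∞) e₂)
    (he1 : ∀ y, |e₁ y| ≤ 1) (w : V) (he₁₂ : ∀ y, e₂ y = e₁ (y + P w))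
    (ψ : 𝓓((⊤ : Opens V), ℝ)) (hψ1 : ∀ x, |ψ x| ≤ 1) {U : Set V} (hU : IsOpen U)
    (hψU : ∀ x ∈ U, ψ x = 1)
    (hXU : ∀ x ∈ X.support, ∀ t ∈ Icc (0 : ℝ) 1, x + t • w ∈ U) :
    |X (smulCovectorCLM (pullbackDet P) (testFunctionMulComp ψ e₁ he₁ P)) -
        X (smulCovectorCLM (pullbackDet P) (testFunctionMulComp ψ e₂ he₂ P))|
      ≤ ‖w‖ * ‖pullbackDet P‖ * X.boundary.mass.toReal := by
  set c := pullbackDet P with hc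
  set Φ := smulCovectorCLM c (testFunctionMulComp ψ e₁ he₁ P) with hΦ
  set Φ' := smulCovectorCLM c (testFunctionMulComp ψ e₂ he₂ P) with hΦ'
  have hXsU : X.support ⊆ U := fun x hx => by
    simpa using hXU x hx 0 ⟨le_rfl, zero_le_one⟩
  -- the maps of the homotopy
  have hf : ContDiff ℝ ∞ (id : V → V) := contDiff_id
  have hg : ContDiff ℝ ∞ (fun x : V => x + w) := contDiff_id.add contDiff_const
  -- a time cutoff `ρ = 1` near `[0, 1]`, `0 ≤ ρ ≤ 1`
  obtain ⟨ρ, Vt, hVt, h01, hρ1, hρ01⟩ := exists_testFunction_eq_one_nhds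
    (Ω := (⊤ : Opens ℝ)) (isCompact_Icc (a := (0 : ℝ)) (b := 1)) (subset_univ _)
  have hρabs : ∀ t, |ρ t| ≤ 1 := fun t => by
    rw [abs_le]; exact ⟨by linarith [(hρ01 t).1], (hρ01 t).2⟩
  -- the homotopy formula, tested against `Φ`
  have hhom := X.homotopy_formula_affine ψ ρ hf hg hU hXsU hψU hVt h01 hρ1 (Ω' := (⊤ : Opens V))
  have happ := DFunLike.congr_fun hhom Φ
  rw [show (X.pushforward ⊤ ψ hg - X.pushforward ⊤ ψ hf) Φ =
      X.pushforward ⊤ ψ hg Φ - X.pushforward ⊤ ψ hf Φ from rfl,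
    show (((X.prodInterval 0 1).pushforward ⊤ (TestFunction.tensorCutoff ρ ψ)
        (contDiff_affineHomotopy hf hg)).boundary +
        (X.boundary.prodInterval 0 1).pushforward ⊤ (TestFunction.tensorCutoff ρ ψ)
          (contDiff_affineHomotopy hf hg)) Φ =
      ((X.prodInterval 0 1).pushforward ⊤ (TestFunction.tensorCutoff ρ ψ)
        (contDiff_affineHomotopy hf hg)).boundary Φ +
        (X.boundary.prodInterval 0 1).pushforward ⊤ (TestFunction.tensorCutoff ρ ψ)
          (contDiff_affineHomotopy hf hg) Φ from rfl] at happ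
  -- (1) `(· + w)_# X (Φ) = X(Φ')`
  have h1 : X.pushforward ⊤ ψ hg Φ = X Φ' := by
    rw [Current.pushforward_apply]
    have hcont : Continuous fun x : V => x + w := continuous_id.add continuous_const
    refine X.apply_eq_of_eqOn_nhds_support (U := U ∩ (fun x : V => x + w) ⁻¹' U)
      (hU.inter (hU.preimage hcont)) (fun x hx => ⟨hXsU hx, ?_⟩) fun x hx => ?_
    · show x + w ∈ U
      simpa using hXU x hx 1 ⟨zero_le_one, le_rfl⟩
    · have hx2 : x + w ∈ U := hx.2
      have hfd : fderiv ℝ (fun x : V => x + w) x = ContinuousLinearMap.id ℝ V := by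
        rw [fderiv_add_const, fderiv_fun_id]
      rw [TestForm.pullback_apply, hfd,
        show Φ (x + w) = (e₁ (P x + P w) * 1) • c by
          simp [hΦ, smulCovectorCLM_apply, testFunctionMulComp_apply, map_add, hψU (x + w) hx2],
        show Φ' x = (e₁ (P x + P w) * 1) • c by
          simp [hΦ', smulCovectorCLM_apply, testFunctionMulComp_apply, hψU x hx.1, he₁₂],
        hψU x hx.1, one_smul]
      ext v
      simp
  -- (2) `id_# X (Φ) = X(Φ)`
  have h2 : X.pushforward ⊤ ψ hf Φ = X Φ := by
    rw [Current.pushforward_apply]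
    refine X.apply_eq_of_eqOn_nhds_support hU hXsU fun x hx => ?_
    rw [TestForm.pullback_apply, fderiv_id, hψU x hx, one_smul]
    ext v
    simp
  -- (3) the boundary term vanishes: `dΦ = 0` on `U ⊇ spt h_#([0,1] × X)`
  have h3 : ((X.prodInterval 0 1).pushforward ⊤ (TestFunction.tensorCutoff ρ ψ)
      (contDiff_affineHomotopy hf hg)).boundary Φ = 0 := by
    rw [Current.boundary_apply]
    refine Current.apply_eq_zero_of_disjoint_support _ (Set.disjoint_left.2 fun x hx hxH => ?_)
    -- `x` lies on a segment `[y, y + w]`, `y ∈ spt X`, hence in `U`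
    have hxU : x ∈ U := by
      have hsub := (Current.support_pushforward_subset _ (TestFunction.tensorCutoff ρ ψ)
        (contDiff_affineHomotopy hf hg)) hxH
      set C := tsupport ⇑(TestFunction.tensorCutoff ρ ψ) with hCdef
      have hC : IsCompact C := (TestFunction.tensorCutoff ρ ψ).hasCompactSupport
      have hS : (X.prodInterval 0 1).support ⊆ Icc (0 : ℝ) 1 ×ˢ X.support := by
        have := X.support_prodInterval_subset 0 1
        rwa [Set.uIcc_of_le zero_le_one] at this
      have hK : IsCompact (C ∩ Icc (0 : ℝ) 1 ×ˢ X.support) :=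
        hC.inter_right (isClosed_Icc.prod hXc.isClosed)
      have himg : closure (affineHomotopy id (fun x : V => x + w) ''
          (C ∩ (X.prodInterval 0 1).support)) ⊆
          affineHomotopy id (fun x : V => x + w) '' (C ∩ Icc (0 : ℝ) 1 ×ˢ X.support) :=
        closure_minimal (image_mono (inter_subset_inter_right _ hS))
          ((hK.image (contDiff_affineHomotopy hf hg).continuous).isClosed)
      obtain ⟨p, ⟨-, hpI, hpX⟩, rfl⟩ := himg hsub
      have : affineHomotopy id (fun x : V => x + w) p = p.2 + p.1 • w := by
        simp [affineHomotopy]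
      rw [this]
      exact hXU p.2 hpX p.1 hpI
    exact (notMem_tsupport_iff_eventuallyEq.2 (Filter.eventually_of_mem (hU.mem_nhds hxU)
      fun y hy => extDerivCLM_pullbackDet_testFunctionMulComp_eq_zero ψ e₁ he₁ P
        (fderiv_eq_zero_of_eqOn_one ψ hU hψU hy))) hx
  -- (4) the mass of the `∂X`-term
  set H' : Current (⊤ : Opens V) (m + 1) := (X.boundary.prodInterval 0 1).pushforward (⊤ : Opens V)
    (TestFunction.tensorCutoff ρ ψ) (contDiff_affineHomotopy hf hg) with hH'
  have hH'mass : H'.mass ≤ ENNReal.ofReal ‖w‖ * X.boundary.mass := by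
    refine X.boundary.mass_affineHomotopy_le ψ ρ hf hg (norm_nonneg w) hρabs fun t _ x _ => ?_
    have hfd : fderiv ℝ (fun x : V => x + w) x = ContinuousLinearMap.id ℝ V := by
      rw [fderiv_add_const, fderiv_fun_id]
    rw [hfd, fderiv_id, sub_self, smul_zero, add_zero, id_eq, add_sub_cancel_left]
    calc |ψ x| * ‖w‖ * ‖ContinuousLinearMap.id ℝ V‖ ^ m ≤ 1 * ‖w‖ * 1 ^ m := by
          gcongr
          · exact hψ1 x
          · exact ContinuousLinearMap.norm_id_le
      _ = ‖w‖ := by rw [one_mul, one_pow, mul_one]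
  have hH'fin : H'.mass ≠ ⊤ :=
    ne_top_of_le_ne_top (ENNReal.mul_ne_top ENNReal.ofReal_ne_top hdX) hH'mass
  -- conclusion
  rw [h1, h2, h3, zero_add] at happ
  -- `happ : X Φ' - X Φ = H' Φ`
  rcases eq_or_lt_of_le (norm_nonneg c) with hc0 | hcpos
  · have hc00 : c = 0 := norm_eq_zero.1 hc0.symm
    have hΦ0 : Φ = 0 := by ext x v; simp [hΦ, hc00]
    have hΦ'0 : Φ' = 0 := by ext x v; simp [hΦ', hc00]
    rw [hΦ0, hΦ'0, map_zero, sub_self, abs_zero]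
    positivity
  have hΦc : ∀ x, ‖Φ x‖ ≤ ‖c‖ := fun x => by
    rw [hΦ, smulCovectorCLM_apply, testFunctionMulComp_apply, norm_smul, Real.norm_eq_abs, abs_mul]
    calc |e₁ (P x)| * |ψ x| * ‖c‖ ≤ 1 * 1 * ‖c‖ := by
          gcongr
          · exact he1 _
          · exact hψ1 _
      _ = ‖c‖ := by ring
  calc |X Φ - X Φ'| = |H' Φ| := by rw [abs_sub_comm, happ]
    _ ≤ ‖c‖ * H'.mass.toReal := H'.abs_apply_le_mul_toReal_mass hH'fin hcpos hΦc
    _ ≤ ‖c‖ * (ENNReal.ofReal ‖w‖ * X.boundary.mass).toReal :=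
        mul_le_mul_of_nonneg_left (ENNReal.toReal_mono
          (ENNReal.mul_ne_top ENNReal.ofReal_ne_top hdX) hH'mass) (norm_nonneg _)
    _ = ‖w‖ * ‖c‖ * X.boundary.mass.toReal := by
        rw [ENNReal.toReal_mul, ENNReal.toReal_ofReal (norm_nonneg _)]; ring

end Translate

/-! ### The absolute-continuity estimate (Fubini average of the translation estimate) -/

section Average

omit [FiniteDimensional ℝ V] [MeasurableSpace V] [BorelSpace V] in
/-- The support of a current on `V` is closed (cf. `Current.isClosed_support_top` in `NullHomotopy`,
not imported here). [folklore] -/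
private theorem Current.isClosed_support' {k : ℕ} (T : Current (⊤ : Opens V) k) : IsClosed T.support := by
  rw [← isOpen_compl_iff, isOpen_iff_mem_nhds]
  intro x hx
  obtain ⟨U, hU, hTU⟩ := T.exists_nhds_of_not_mem_support (mem_univ x) hx
  obtain ⟨U', hU'U, hU'o, hxU'⟩ := _root_.mem_nhds_iff.1 hU
  refine mem_of_superset (hU'o.mem_nhds hxU') fun y hy hyT => ?_
  obtain ⟨φ, hφ, hne⟩ := hyT.2 U' (hU'o.mem_nhds hy)
  exact hne (hTU φ (hφ.trans hU'U))

/-- The values of `X ⌞ ψ'` on the forms `(e ∘ P) ψ • P^♯DY` through the polar decomposition of `X`: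
`(X ⌞ ψ')((e∘P) ψ • c) = ∫ ψ' e(Px) ψ ⟨c, X⃗(x)⟩ d‖X‖`. [cite: Federer1969, 4.1.5, 4.1.7] -/
theorem Current.smulFun_apply_pullbackDet_eq_integral (X : Current (⊤ : Opens V) (m + 1))
    (hX : X.mass ≠ ⊤) (ψ' : 𝓓((⊤ : Opens V), ℝ)) (P : V →L[ℝ] (Fin (m + 1) → ℝ))
    (e : (Fin (m + 1) → ℝ) → ℝ) (he : ContDiff ℝ (⊤ : ℕ∞) e) (ψ : 𝓓((⊤ : Opens V), ℝ)) :
    X.smulFun ψ'.contDiff (smulCovectorCLM (pullbackDet P) (testFunctionMulComp ψ e he P)) =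
      ∫ x, ψ' x * (e (P x) * ψ x) *
        (X.isRepresentable_of_mass_ne_top hX).polar hX x (pullbackDet P) ∂X.variation := by
  rw [Current.smulFun_apply, (X.isRepresentable_of_mass_ne_top hX).apply_eq_integral_polar hX]
  refine integral_congr_ae (Eventually.of_forall fun x => ?_)
  simp only [TestForm.smulFun_apply, smulCovectorCLM_apply, testFunctionMulComp_apply, map_smul,
    smul_eq_mul]
  ring

/-- **The absolute-continuity estimate.** Let `X` be normal with compact support, `ψ'` a test
function, `P : V → ℝ^{m+1}` linear with right inverse `Q`, `ψ` a cutoff equal to `1` on an open `U`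
containing all segments `[x, x + t Q u]`, `x ∈ spt X`, `‖u‖ ≤ ε`, and `e : ℝ^{m+1} → [0, 1]` smooth
and integrable. Then, with `K = ⟨P^♯DY, X⃗⟩`,
`ℒ(𝐁_ε) · |∫ ψ' (e∘P) ψ K d‖X‖| ≤ ‖P^♯DY‖ C_{ψ'} ‖e‖₁ 𝐌(X) + ℒ(𝐁_ε) ‖Q‖ ε ‖P^♯DY‖ 𝐌(∂(X ⌞ ψ'))`:
average the translation estimate for `X ⌞ ψ'` over `u ∈ 𝐁_ε` and compute the average of the
translated values by Fubini, `∫_{𝐁_ε} e(Px + u) du ≤ ‖e‖₁`. [cite: Federer1969, 4.1.18, 4.1.20] -/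
theorem Current.volume_mul_abs_integral_pullbackDet_le (X : Current (⊤ : Opens V) (m + 1))
    (hX : X.mass ≠ ⊤) (hXc : IsCompact X.support) (ψ' : 𝓓((⊤ : Opens V), ℝ)) {Cψ : ℝ}
    (hCψ : ∀ x, |ψ' x| ≤ Cψ) (hdY : (X.smulFun ψ'.contDiff).boundary.mass ≠ ⊤)
    (P : V →L[ℝ] (Fin (m + 1) → ℝ)) (Q : (Fin (m + 1) → ℝ) →L[ℝ] V) (hPQ : ∀ u, P (Q u) = u)
    (e : (Fin (m + 1) → ℝ) → ℝ) (he : ContDiff ℝ (⊤ : ℕ∞) e) (he01 : ∀ y, e y ∈ Icc (0 : ℝ) 1)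
    (hei : Integrable e) (ψ : 𝓓((⊤ : Opens V), ℝ)) (hψ1 : ∀ x, |ψ x| ≤ 1) {U : Set V}
    (hU : IsOpen U) (hψU : ∀ x ∈ U, ψ x = 1) {ε : ℝ}
    (hXU : ∀ x ∈ X.support, ∀ u ∈ closedBall (0 : Fin (m + 1) → ℝ) ε, ∀ t ∈ Icc (0 : ℝ) 1,
      x + t • Q u ∈ U) :
    (volume (closedBall (0 : Fin (m + 1) → ℝ) ε)).toReal *
        |∫ x, ψ' x * (e (P x) * ψ x) *
          (X.isRepresentable_of_mass_ne_top hX).polar hX x (pullbackDet P) ∂X.variation| ≤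
      ‖pullbackDet P‖ * (Cψ * (∫ y, e y) * X.mass.toReal) +
        (volume (closedBall (0 : Fin (m + 1) → ℝ) ε)).toReal *
          (‖Q‖ * ε * ‖pullbackDet P‖ * (X.smulFun ψ'.contDiff).boundary.mass.toReal) := by
  set μ := X.variation with hμ
  haveI : IsFiniteMeasure μ := X.isFiniteMeasure_variation hX
  set hXr := X.isRepresentable_of_mass_ne_top hX with hXr_def
  set c := pullbackDet P with hc
  set K : V → ℝ := fun x => hXr.polar hX x c with hK
  set Y := X.smulFun ψ'.contDiff with hY
  set B := closedBall (0 : Fin (m + 1) → ℝ) ε with hB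
  have hBfin : volume B < ⊤ := measure_closedBall_lt_top
  haveI : IsFiniteMeasure ((volume : Measure (Fin (m + 1) → ℝ)).restrict B) :=
    ⟨by rw [Measure.restrict_apply_univ]; exact hBfin⟩
  have hCψ0 : 0 ≤ Cψ := (abs_nonneg _).trans (hCψ 0)
  -- the support of `Y` and compactness
  have hYc : IsCompact Y.support :=
    hXc.of_isClosed_subset Y.isClosed_support' (X.support_smulFun_subset ψ'.contDiff)
  -- integrability and bounds for `K`
  have hKi : Integrable K μ := hXr.integrable_polar_apply hX (integrable_const c)
  have hKle : ∀ᵐ x ∂μ, ‖K x‖ ≤ ‖c‖ := by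
    filter_upwards [hXr.norm_polar_ae_eq_one hX] with x hx
    calc ‖K x‖ ≤ ‖hXr.polar hX x‖ * ‖c‖ := (hXr.polar hX x).le_opNorm c
      _ = ‖c‖ := by rw [hx, one_mul]
  -- the family of translated forms and their values
  have hef : ∀ u : Fin (m + 1) → ℝ, ContDiff ℝ (⊤ : ℕ∞) fun y => e (y + u) := fun u =>
    he.comp (contDiff_id.add contDiff_const)
  set F : (Fin (m + 1) → ℝ) × V → ℝ := fun p => ψ' p.2 * (e (P p.2 + p.1) * ψ p.2) * K p.2 with hF
  have hval : ∀ u, Y (smulCovectorCLM c (testFunctionMulComp ψ (fun y => e (y + u)) (hef u) P)) =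
      ∫ x, F (u, x) ∂μ := fun u =>
    X.smulFun_apply_pullbackDet_eq_integral hX ψ' P _ (hef u) ψ
  -- integrability of `F` on `𝐁_ε × V`
  have hpol : StronglyMeasurable (hXr.polar hX) := hXr.stronglyMeasurable_polar hX
  have hKsm : StronglyMeasurable K :=
    (ContinuousLinearMap.apply ℝ ℝ c).continuous.comp_stronglyMeasurable hpol
  have hFm : AEStronglyMeasurable F (((volume : Measure (Fin (m + 1) → ℝ)).restrict B).prod μ) := by
    have hec : Continuous e := he.continuous
    have hψc : Continuous (ψ : V → ℝ) := ψ.contDiff.continuous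
    have hψ'c : Continuous (ψ' : V → ℝ) := ψ'.contDiff.continuous
    have h1 : Continuous fun p : (Fin (m + 1) → ℝ) × V => ψ' p.2 * (e (P p.2 + p.1) * ψ p.2) := by
      fun_prop
    exact h1.aestronglyMeasurable.mul (hKsm.comp_measurable measurable_snd).aestronglyMeasurable
  have hFi : Integrable F (((volume : Measure (Fin (m + 1) → ℝ)).restrict B).prod μ) := by
    refine Integrable.mono' ((integrable_const Cψ).mul_prod hKi.norm) hFm (Eventually.of_forall ?_)
    rintro ⟨u, x⟩
    simp only [hF, norm_mul, Real.norm_eq_abs]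
    have h1 : |e (P x + u)| ≤ 1 := abs_le.2 ⟨by linarith [(he01 (P x + u)).1], (he01 _).2⟩
    calc |ψ' x| * (|e (P x + u)| * |ψ x|) * |K x| ≤ Cψ * (1 * 1) * |K x| := by
          gcongr
          · exact hCψ x
          · exact hψ1 x
      _ = Cψ * ‖K x‖ := by rw [mul_one, mul_one, Real.norm_eq_abs]
  -- (1) the translation estimate for `Y`, `u ∈ 𝐁_ε`
  have htr : ∀ u ∈ B, |∫ x, F (0, x) ∂μ - ∫ x, F (u, x) ∂μ| ≤
      ‖Q‖ * ε * ‖c‖ * Y.boundary.mass.toReal := by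
    intro u hu
    have hu' : ‖u‖ ≤ ε := by simpa [hB, dist_zero_right] using hu
    rw [← hval 0, ← hval u]
    have he1 : ∀ y, |e (y + 0)| ≤ 1 := fun y =>
      abs_le.2 ⟨by linarith [(he01 (y + 0)).1], (he01 _).2⟩
    refine (Y.abs_apply_pullbackDet_sub_translate_le hYc hdY P (fun y => e (y + 0))
      (fun y => e (y + u)) (hef 0) (hef u) he1 (Q u) (fun y => by rw [hPQ, add_zero])
      ψ hψ1 hU hψU fun x hx t ht => hXU x (X.support_smulFun_subset ψ'.contDiff hx) u hu t ht).trans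
      ?_
    have hQu : ‖Q u‖ ≤ ‖Q‖ * ε := (Q.le_opNorm u).trans (mul_le_mul_of_nonneg_left hu' (norm_nonneg _))
    gcongr
  -- (2) Fubini: the average of the translated values
  have hswap : (∫ u in B, ∫ x, F (u, x) ∂μ) = ∫ x, (∫ u in B, F (u, x)) ∂μ :=
    integral_integral_swap (f := fun u x => F (u, x)) hFi
  set Ie := ∫ y, e y with hIe
  have hIe0 : 0 ≤ Ie := integral_nonneg fun y => (he01 y).1
  have hinner : ∀ x, |∫ u in B, F (u, x)| ≤ Cψ * Ie * |K x| := by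
    intro x
    have h1 : ∫ u in B, F (u, x) = ψ' x * ψ x * K x * ∫ u in B, e (P x + u) := by
      rw [← integral_const_mul]
      refine integral_congr_ae (Eventually.of_forall fun u => ?_)
      simp only [hF]; ring
    have h2 : 0 ≤ ∫ u in B, e (P x + u) := integral_nonneg fun u => (he01 _).1
    have h3 : ∫ u in B, e (P x + u) ≤ Ie := by
      calc ∫ u in B, e (P x + u) ≤ ∫ u, e (P x + u) :=
            setIntegral_le_integral (hei.comp_add_left (P x)) (Eventually.of_forall fun u => (he01 _).1)
        _ = Ie := integral_add_left_eq_self e (P x)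
    rw [h1, abs_mul, abs_mul, abs_mul, abs_of_nonneg h2]
    calc |ψ' x| * |ψ x| * |K x| * ∫ u in B, e (P x + u) ≤ Cψ * 1 * |K x| * Ie := by
          gcongr
          · exact hCψ x
          · exact hψ1 x
      _ = Cψ * Ie * |K x| := by ring
  have havg : |∫ u in B, ∫ x, F (u, x) ∂μ| ≤ ‖c‖ * (Cψ * Ie * X.mass.toReal) := by
    rw [hswap]
    calc |∫ x, (∫ u in B, F (u, x)) ∂μ| ≤ ∫ x, Cψ * Ie * ‖K x‖ ∂μ := by
          rw [← Real.norm_eq_abs]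
          refine norm_integral_le_of_norm_le ((hKi.norm).const_mul _) (Eventually.of_forall fun x => ?_)
          rw [Real.norm_eq_abs, Real.norm_eq_abs]
          exact hinner x
      _ ≤ ∫ _, Cψ * Ie * ‖c‖ ∂μ := by
          refine integral_mono_ae ((hKi.norm).const_mul _) (integrable_const _) ?_
          filter_upwards [hKle] with x hx
          exact mul_le_mul_of_nonneg_left hx (mul_nonneg hCψ0 hIe0)
      _ = ‖c‖ * (Cψ * Ie * X.mass.toReal) := by
          rw [integral_const, smul_eq_mul, measureReal_def, hμ, Current.variation_univ]; ring
  -- (3) averaging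
  have hsplit : (volume B).toReal * ∫ x, F (0, x) ∂μ =
      (∫ u in B, ∫ x, F (u, x) ∂μ) + ∫ u in B, (∫ x, F (0, x) ∂μ - ∫ x, F (u, x) ∂μ) := by
    have h1 : Integrable (fun u => ∫ x, F (u, x) ∂μ) ((volume : Measure (Fin (m + 1) → ℝ)).restrict B) :=
      hFi.integral_prod_left
    have h2 : Integrable (fun _ : Fin (m + 1) → ℝ => ∫ x, F (0, x) ∂μ)
        ((volume : Measure (Fin (m + 1) → ℝ)).restrict B) := integrable_const _
    rw [integral_sub h2 h1, setIntegral_const, smul_eq_mul, measureReal_def]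
    ring
  have hrest : |∫ u in B, (∫ x, F (0, x) ∂μ - ∫ x, F (u, x) ∂μ)| ≤
      ‖Q‖ * ε * ‖c‖ * Y.boundary.mass.toReal * (volume B).toReal := by
    rw [← Real.norm_eq_abs]
    have := norm_setIntegral_le_of_norm_le_const hBfin (f := fun u => ∫ x, F (0, x) ∂μ - ∫ x, F (u, x) ∂μ)
      (μ := volume) fun u hu => by rw [Real.norm_eq_abs]; exact htr u hu
    simpa [measureReal_def] using this
  -- the integral in the statement is `∫ F(0, ·)`
  have h0 : ∫ x, ψ' x * (e (P x) * ψ x) * hXr.polar hX x c ∂μ = ∫ x, F (0, x) ∂μ := by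
    simp only [hF, hK, add_zero]
  rw [h0]
  calc (volume B).toReal * |∫ x, F (0, x) ∂μ| = |(volume B).toReal * ∫ x, F (0, x) ∂μ| := by
        rw [abs_mul, abs_of_nonneg ENNReal.toReal_nonneg]
    _ ≤ |∫ u in B, ∫ x, F (u, x) ∂μ| + |∫ u in B, (∫ x, F (0, x) ∂μ - ∫ x, F (u, x) ∂μ)| := by
        rw [hsplit]; exact abs_add_le _ _
    _ ≤ ‖c‖ * (Cψ * Ie * X.mass.toReal) +
        (volume B).toReal * (‖Q‖ * ε * ‖c‖ * Y.boundary.mass.toReal) := by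
        rw [mul_comm (volume B).toReal]
        exact add_le_add havg hrest

end Average

/-! ### Letting the cutoff shrink to a null set -/

section NullSet

/-- **A normal current does not see `P`-preimages of Lebesgue-null sets through `P^♯DY`**: for
`X` normal with compact support, `P : V → ℝ^{m+1}` linear with a right inverse, `A ⊆ ℝ^{m+1}`
compact with `ℒ^{m+1}(A) = 0` and every test function `ψ'`,
`∫ ψ'(x) 1_A(P x) ⟨P^♯DY, X⃗(x)⟩ d‖X‖(x) = 0` (let smooth `e_j ↓ 1_A` in the absolute-continuity
estimate, then `ε → 0`). [cite: Federer1969, 4.1.20] -/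
theorem Current.integral_indicator_preimage_mul_polar_eq_zero (X : Current (⊤ : Opens V) (m + 1))
    (hX : X.mass ≠ ⊤) (hdX : X.boundary.mass ≠ ⊤) (hXc : IsCompact X.support)
    (P : V →L[ℝ] (Fin (m + 1) → ℝ)) (Q : (Fin (m + 1) → ℝ) →L[ℝ] V) (hPQ : ∀ u, P (Q u) = u)
    {A : Set (Fin (m + 1) → ℝ)} (hA : IsCompact A) (hA0 : volume A = 0)
    (ψ' : 𝓓((⊤ : Opens V), ℝ)) :
    ∫ x, ψ' x * A.indicator 1 (P x) *
      (X.isRepresentable_of_mass_ne_top hX).polar hX x (pullbackDet P) ∂X.variation = 0 := by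
  set μ := X.variation with hμ
  haveI : IsFiniteMeasure μ := X.isFiniteMeasure_variation hX
  set hXr := X.isRepresentable_of_mass_ne_top hX with hXr_def
  set c := pullbackDet P with hc
  set K : V → ℝ := fun x => hXr.polar hX x c with hK
  obtain ⟨Cψ, hCψ'⟩ := ψ'.hasCompactSupport.exists_bound_of_continuous ψ'.contDiff.continuous
  have hCψ : ∀ x, |ψ' x| ≤ Cψ := fun x => by simpa [Real.norm_eq_abs] using hCψ' x
  have hCψ0 : 0 ≤ Cψ := (abs_nonneg _).trans (hCψ 0)
  have hdY := (X.mass_smulFun_ne_top_and hX hdX ψ').2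
  -- a cutoff `ψ = 1` on a neighbourhood of all segments `[x, x + t Q u]`, `x ∈ spt X`, `‖u‖ ≤ 1`
  obtain ⟨ψ, U, hU, hKU, hψU, hψ01⟩ := exists_testFunction_eq_one_nhds (Ω := (⊤ : Opens V))
    (hXc.cthickening (r := ‖Q‖)) (subset_univ _)
  have hψ1 : ∀ x, |ψ x| ≤ 1 := fun x => abs_le.2 ⟨by linarith [(hψ01 x).1], (hψ01 x).2⟩
  have hXU : ∀ {ε : ℝ}, ε ≤ 1 → ∀ x ∈ X.support, ∀ u ∈ closedBall (0 : Fin (m + 1) → ℝ) ε,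
      ∀ t ∈ Icc (0 : ℝ) 1, x + t • Q u ∈ U := by
    intro ε hε1 x hx u hu t ht
    refine hKU (Metric.mem_cthickening_of_dist_le _ x _ _ hx ?_)
    rw [dist_eq_norm, add_sub_cancel_left, norm_smul, Real.norm_eq_abs, abs_of_nonneg ht.1]
    have hu' : ‖u‖ ≤ 1 := by
      have : ‖u‖ ≤ ε := by simpa [dist_zero_right] using hu
      exact this.trans hε1
    calc t * ‖Q u‖ ≤ 1 * (‖Q‖ * ‖u‖) := mul_le_mul ht.2 (Q.le_opNorm u) (norm_nonneg _) zero_le_one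
      _ ≤ 1 * (‖Q‖ * 1) := by gcongr
      _ = ‖Q‖ := by ring
  -- `K` integrable, a.e. bounded
  have hKi : Integrable K μ := hXr.integrable_polar_apply hX (integrable_const c)
  have hpol : StronglyMeasurable (hXr.polar hX) := hXr.stronglyMeasurable_polar hX
  have hKsm : StronglyMeasurable K :=
    (ContinuousLinearMap.apply ℝ ℝ c).continuous.comp_stronglyMeasurable hpol
  -- the integral with `ψ`: `G = ∫ ψ' 1_A(P·) ψ K`
  set G := ∫ x, ψ' x * (A.indicator 1 (P x) * ψ x) * K x ∂μ with hG
  -- Step 1: `|G| ≤ ‖Q‖ ‖c‖ 𝐌(∂Y) ε` for `0 < ε ≤ 1`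
  have hGε : ∀ ε : ℝ, 0 < ε → ε ≤ 1 →
      |G| ≤ ‖Q‖ * ε * ‖c‖ * (X.smulFun ψ'.contDiff).boundary.mass.toReal := by
    intro ε hε hε1
    set B := closedBall (0 : Fin (m + 1) → ℝ) ε with hB
    have hvB : 0 < (volume B).toReal :=
      ENNReal.toReal_pos (measure_closedBall_pos volume _ hε).ne' measure_closedBall_lt_top.ne
    -- the cutoffs `e_j`
    have hcut : ∀ j : ℕ, ∃ e : (Fin (m + 1) → ℝ) → ℝ, ContDiff ℝ (⊤ : ℕ∞) e ∧
        (∀ y, e y ∈ Icc (0 : ℝ) 1) ∧ EqOn e 1 (cthickening (1 / ((j : ℝ) + 1) / 2) A) ∧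
        EqOn e 0 (thickening (1 / ((j : ℝ) + 1)) A)ᶜ := fun j =>
      exists_smooth_cutoff A (by positivity)
    choose e he he01 he1 he0 using hcut
    -- `e_j` is integrable, `∫ e_j ≤ ℒ(thickening)`
    have hesupp : ∀ j, Function.support (e j) ⊆ thickening (1 / ((j : ℝ) + 1)) A := fun j y hy => by
      by_contra h; exact hy (he0 j h)
    have hei : ∀ j, Integrable (e j) := fun j => by
      refine (he j).continuous.integrable_of_hasCompactSupport ?_
      exact HasCompactSupport.of_support_subset_isCompact (hA.cthickening)
        ((hesupp j).trans (thickening_subset_cthickening _ _))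
    -- the estimate for each `j`
    have hest : ∀ j, (volume B).toReal * |∫ x, ψ' x * (e j (P x) * ψ x) * K x ∂μ| ≤
        ‖c‖ * (Cψ * (∫ y, e j y) * X.mass.toReal) +
          (volume B).toReal * (‖Q‖ * ε * ‖c‖ * (X.smulFun ψ'.contDiff).boundary.mass.toReal) :=
      fun j => X.volume_mul_abs_integral_pullbackDet_le hX hXc ψ' hCψ hdY P Q hPQ (e j) (he j)
        (he01 j) (hei j) ψ hψ1 hU hψU (hXU hε1)
    -- `∫ ψ' (e_j ∘ P) ψ K → G`
    have hlimG : Tendsto (fun j => ∫ x, ψ' x * (e j (P x) * ψ x) * K x ∂μ) atTop (𝓝 G) := by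
      refine tendsto_integral_of_dominated_convergence (fun x => Cψ * ‖K x‖) (fun j => ?_)
        ((hKi.norm).const_mul _) (fun j => Eventually.of_forall fun x => ?_)
        (Eventually.of_forall fun x => ?_)
      · exact ((ψ'.contDiff.continuous.mul (((he j).continuous.comp P.continuous).mul
          ψ.contDiff.continuous)).aestronglyMeasurable).mul hKsm.aestronglyMeasurable
      · rw [norm_mul, norm_mul, norm_mul, Real.norm_eq_abs, Real.norm_eq_abs, Real.norm_eq_abs]
        have h1 : |e j (P x)| ≤ 1 := abs_le.2 ⟨by linarith [(he01 j (P x)).1], (he01 j _).2⟩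
        calc |ψ' x| * (|e j (P x)| * |ψ x|) * ‖K x‖ ≤ Cψ * (1 * 1) * ‖K x‖ := by
              gcongr
              · exact hCψ x
              · exact hψ1 x
          _ = Cψ * ‖K x‖ := by ring
      · have hpt : Tendsto (fun j => e j (P x)) atTop (𝓝 (A.indicator 1 (P x))) := by
          by_cases hPx : P x ∈ A
          · have h1 : ∀ j, e j (P x) = 1 := fun j =>
              he1 j (Metric.self_subset_cthickening _ hPx)
            simp only [h1, indicator_of_mem hPx, Pi.one_apply]
            exact tendsto_const_nhds
          · have hpos : 0 < Metric.infEDist (P x) A := by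
              rw [Metric.infEDist_pos_iff_notMem_closure, hA.isClosed.closure_eq]; exact hPx
            have h0 : Tendsto (fun j : ℕ => ENNReal.ofReal (1 / ((j : ℝ) + 1))) atTop (𝓝 0) := by
              simpa using ENNReal.tendsto_ofReal (tendsto_one_div_add_atTop_nhds_zero_nat (𝕜 := ℝ))
            have hev : ∀ᶠ j : ℕ in atTop, e j (P x) = A.indicator 1 (P x) := by
              filter_upwards [h0.eventually (gt_mem_nhds hpos)] with j hj
              rw [indicator_of_notMem hPx]
              refine he0 j fun hmem => ?_
              exact (lt_irrefl _) ((Metric.mem_thickening_iff_infEDist_lt.1 hmem).trans hj)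
            exact tendsto_const_nhds.congr' (hev.mono fun j hj => hj.symm)
        exact (tendsto_const_nhds.mul (hpt.mul tendsto_const_nhds)).mul tendsto_const_nhds
    -- `∫ e_j → 0`
    have hlimI : Tendsto (fun j => ∫ y, e j y) atTop (𝓝 0) := by
      have hbdd : ∀ r : ℝ, volume (thickening r A) < ⊤ := fun r =>
        (hA.isBounded.thickening).measure_lt_top
      have hup : ∀ j, ∫ y, e j y ≤ (volume (thickening (1 / ((j : ℝ) + 1)) A)).toReal := by
        intro j
        have hT : IntegrableOn (fun _ => (1 : ℝ)) (thickening (1 / ((j : ℝ) + 1)) A) volume :=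
          integrableOn_const (hbdd _).ne
        calc ∫ y, e j y = ∫ y in thickening (1 / ((j : ℝ) + 1)) A, e j y :=
              (setIntegral_eq_integral_of_forall_compl_eq_zero fun y hy => he0 j hy).symm
          _ ≤ ∫ _ in thickening (1 / ((j : ℝ) + 1)) A, (1 : ℝ) :=
              setIntegral_mono (hei j).integrableOn hT fun y => (he01 j y).2
          _ = (volume (thickening (1 / ((j : ℝ) + 1)) A)).toReal := by
              rw [setIntegral_const, smul_eq_mul, mul_one, measureReal_def]
      have hthick : Tendsto (fun j : ℕ => (volume (thickening (1 / ((j : ℝ) + 1)) A)).toReal)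
          atTop (𝓝 0) := by
        have h1 : Tendsto (fun r : ℝ => volume (thickening r A)) (𝓝[>] 0) (𝓝 (volume A)) :=
          tendsto_measure_thickening_of_isClosed ⟨1, one_pos, (hbdd 1).ne⟩ hA.isClosed
        rw [hA0] at h1
        have h2 : Tendsto (fun j : ℕ => 1 / ((j : ℝ) + 1)) atTop (𝓝[>] (0 : ℝ)) :=
          tendsto_nhdsWithin_iff.2 ⟨tendsto_one_div_add_atTop_nhds_zero_nat,
            Eventually.of_forall fun j => show (0 : ℝ) < 1 / ((j : ℝ) + 1) by positivity⟩
        have h3 := (ENNReal.tendsto_toReal ENNReal.zero_ne_top).comp (h1.comp h2)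
        simpa [Function.comp_def] using h3
      exact squeeze_zero (fun j => integral_nonneg fun y => (he01 j y).1) hup hthick
    -- pass to the limit
    set M := (X.smulFun ψ'.contDiff).boundary.mass.toReal with hM
    have hlim1 : Tendsto (fun j => (volume B).toReal * |∫ x, ψ' x * (e j (P x) * ψ x) * K x ∂μ|)
        atTop (𝓝 ((volume B).toReal * |G|)) :=
      ((continuous_abs.tendsto G).comp hlimG).const_mul _
    have hlim2 : Tendsto (fun j => ‖c‖ * (Cψ * (∫ y, e j y) * X.mass.toReal) +
        (volume B).toReal * (‖Q‖ * ε * ‖c‖ * M)) atTop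
        (𝓝 (‖c‖ * (Cψ * 0 * X.mass.toReal) + (volume B).toReal * (‖Q‖ * ε * ‖c‖ * M))) :=
      (((hlimI.const_mul Cψ).mul_const _).const_mul _).add tendsto_const_nhds
    have hfinal := le_of_tendsto_of_tendsto' hlim1 hlim2 hest
    rw [mul_zero, zero_mul, mul_zero, zero_add] at hfinal
    exact le_of_mul_le_mul_left hfinal hvB
  -- Step 2: `G = 0`
  have hG0 : G = 0 := by
    set M := (X.smulFun ψ'.contDiff).boundary.mass.toReal with hM
    have hle : |G| ≤ 0 := by
      have ht : Tendsto (fun t : ℝ => ‖Q‖ * t * ‖c‖ * M) (𝓝[>] (0 : ℝ)) (𝓝 (‖Q‖ * 0 * ‖c‖ * M)) :=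
        ((((tendsto_id.const_mul ‖Q‖).mul_const ‖c‖).mul_const M).mono_left nhdsWithin_le_nhds)
      rw [mul_zero, zero_mul, zero_mul] at ht
      exact ge_of_tendsto ht (by
        filter_upwards [Ioc_mem_nhdsGT (zero_lt_one' ℝ)] with t ht using hGε t ht.1 ht.2)
    exact abs_nonpos_iff.1 hle
  -- Step 3: remove the cutoff `ψ` (`ψ = 1` on `spt X`, `‖X‖(V ∖ spt X) = 0`)
  have hae : ∀ᵐ x ∂μ, ψ x = 1 := by
    have h0 : μ (X.support)ᶜ = 0 :=
      X.variation_eq_zero_of_disjoint_support X.isClosed_support'.isOpen_compl disjoint_compl_left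
    filter_upwards [(measure_eq_zero_iff_ae_notMem (μ := μ)).1 h0] with x hx
    exact hψU x (hKU (Metric.self_subset_cthickening _ (not_notMem.1 hx)))
  calc ∫ x, ψ' x * A.indicator 1 (P x) * K x ∂μ = G := by
        refine integral_congr_ae ?_
        filter_upwards [hae] with x hx
        rw [hx, mul_one]
    _ = 0 := hG0

/-- **`1_{P⁻¹A} ⟨P^♯DY, X⃗⟩ = 0` `‖X‖`-almost everywhere** for `X` normal with compact support,
`P` linear with a right inverse and `A ⊆ ℝ^{m+1}` compact Lebesgue-null (the previous statement for
all test functions `ψ'`, and the fundamental lemma of the calculus of variations).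
[cite: Federer1969, 4.1.20] -/
theorem Current.ae_indicator_preimage_mul_polar_eq_zero (X : Current (⊤ : Opens V) (m + 1))
    (hX : X.mass ≠ ⊤) (hdX : X.boundary.mass ≠ ⊤) (hXc : IsCompact X.support)
    (P : V →L[ℝ] (Fin (m + 1) → ℝ)) (Q : (Fin (m + 1) → ℝ) →L[ℝ] V) (hPQ : ∀ u, P (Q u) = u)
    {A : Set (Fin (m + 1) → ℝ)} (hA : IsCompact A) (hA0 : volume A = 0) :
    ∀ᵐ x ∂X.variation, A.indicator (1 : (Fin (m + 1) → ℝ) → ℝ) (P x) *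
      (X.isRepresentable_of_mass_ne_top hX).polar hX x (pullbackDet P) = 0 := by
  set μ := X.variation with hμ
  haveI : IsFiniteMeasure μ := X.isFiniteMeasure_variation hX
  set hXr := X.isRepresentable_of_mass_ne_top hX with hXr_def
  set c := pullbackDet P with hc
  have hpol : StronglyMeasurable (hXr.polar hX) := hXr.stronglyMeasurable_polar hX
  have hKsm : StronglyMeasurable fun x => hXr.polar hX x c :=
    (ContinuousLinearMap.apply ℝ ℝ c).continuous.comp_stronglyMeasurable hpol
  have hind : Measurable fun x : V => A.indicator (1 : (Fin (m + 1) → ℝ) → ℝ) (P x) :=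
    (measurable_one.indicator hA.isClosed.measurableSet).comp P.continuous.measurable
  have hfi : Integrable (fun x => A.indicator (1 : (Fin (m + 1) → ℝ) → ℝ) (P x) *
      hXr.polar hX x c) μ := by
    refine Integrable.mono' (hXr.integrable_polar_apply hX (integrable_const c)).norm
      (hind.aestronglyMeasurable.mul hKsm.aestronglyMeasurable) (Eventually.of_forall fun x => ?_)
    rw [norm_mul, Real.norm_eq_abs]
    refine mul_le_of_le_one_left (norm_nonneg _) ?_
    by_cases hPx : P x ∈ A
    · rw [indicator_of_mem hPx, Pi.one_apply, abs_one]
    · rw [indicator_of_notMem hPx, abs_zero]; exact zero_le_one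
  refine ae_eq_zero_of_integral_contDiff_smul_eq_zero hfi.locallyIntegrable fun g hg hgs => ?_
  set ψ' : 𝓓((⊤ : Opens V), ℝ) := ⟨g, hg, hgs, fun _ _ => trivial⟩ with hψ'
  have h := X.integral_indicator_preimage_mul_polar_eq_zero hX hdX hXc P Q hPQ hA hA0 ψ'
  rw [← h]
  refine integral_congr_ae (Eventually.of_forall fun x => ?_)
  show g x • _ = ψ' x * _ * _
  rw [smul_eq_mul, mul_assoc]
  rfl

end NullSet

/-! ### The main theorem -/

section Main

omit [MeasurableSpace V] [BorelSpace V] in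
open Set.powersetCard in
/-- A right inverse of the coordinate projection `𝐩_λ : V → ℝ^k` of a basis: `u ↦ Σ_j u_j b_{λ_j}`.
[folklore] -/
private theorem exists_rightInverse_coordProj {n k : ℕ} (b : Module.Basis (Fin n) ℝ V)
    (s : Set.powersetCard (Fin n) k) :
    ∃ Q : (Fin k → ℝ) →L[ℝ] V, ∀ u, coordProj b s (Q u) = u := by
  classical
  set L : (Fin k → ℝ) →ₗ[ℝ] V := ∑ j : Fin k, (LinearMap.proj j).smulRight (b (ofFinEmbEquiv.symm s j))
    with hL
  refine ⟨LinearMap.toContinuousLinearMap L, fun u => ?_⟩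
  ext i
  rw [coordProj_apply, LinearMap.coe_toContinuousLinearMap', hL, LinearMap.sum_apply, map_sum]
  simp only [LinearMap.smulRight_apply, LinearMap.proj_apply, map_smul,
    Module.Basis.coord_apply, Module.Basis.repr_self, smul_eq_mul]
  rw [Finset.sum_eq_single i]
  · rw [Finsupp.single_eq_same, mul_one]
  · intro j _ hji
    rw [Finsupp.single_eq_of_ne, mul_zero]
    exact fun h => hji ((ofFinEmbEquiv.symm s).injective h).symm
  · intro h; exact absurd (Finset.mem_univ i) h

/-- **Normal currents do not charge `𝓗^{m+1}`-null sets** [Federer1969, 4.1.20–4.1.21 for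
`𝐍_{m+1}`]: if `T` is an `(m+1)`-dimensional current in `V` with `𝐌(T) < ∞`, `𝐌(∂T) < ∞` and
compact support, and `𝓗^{m+1}(E) = 0`, then `‖T‖(E) = 0`. Proof: by inner regularity it suffices
to treat compact `K ⊆ E`; then `(T ⌞ K)(φ) = ∫_K ⟨φ, T⃗⟩ d‖T‖ = Σ_λ ∫_K φ_λ ⟨𝐩_λ^♯DY, T⃗⟩ d‖T‖`
(expansion of `φ` in the decomposable covectors of a basis), and each integrand vanishes a.e. by
`Current.ae_indicator_preimage_mul_polar_eq_zero` applied with the Lebesgue-null compact set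
`A = 𝐩_λ(K)` (`ℒ^{m+1}(𝐩_λ K) ≤ Lip(𝐩_λ)^{m+1} 𝓗^{m+1}(K) = 0`). [cite: Federer1969, 4.1.20, 4.1.21] -/
theorem Current.variation_eq_zero_of_hausdorffMeasure_eq_zero (T : Current (⊤ : Opens V) (m + 1))
    (hT : T.mass ≠ ⊤) (hdT : T.boundary.mass ≠ ⊤) (hTc : IsCompact T.support) {E : Set V}
    (hE : μH[((m : ℝ) + 1)] E = 0) : T.variation E = 0 := by
  classical
  set μ := T.variation with hμ
  haveI : IsFiniteMeasure μ := T.isFiniteMeasure_variation hT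
  set hTr := T.isRepresentable_of_mass_ne_top hT with hTr_def
  -- reduce to compact subsets
  obtain ⟨E', hEE', hE'm, hE'0⟩ := exists_measurable_superset_of_null hE
  suffices hK : ∀ K : Set V, K ⊆ E' → IsCompact K → μ K = 0 by
    refine le_antisymm ((measure_mono hEE').trans ?_) bot_le
    rw [hE'm.measure_eq_iSup_isCompact_of_ne_top (measure_ne_top μ E')]
    exact iSup₂_le fun K hKE => iSup_le fun hKc => (hK K hKE hKc).le
  intro K hKE hKc
  have hKm : MeasurableSet K := hKc.isClosed.measurableSet
  have hK0 : μH[((m : ℝ) + 1)] K = 0 := measure_mono_null hKE hE'0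
  -- `‖T‖(K) = 𝐌(T ⌞ K)` and `T ⌞ K = 0`
  rw [← hTr.mass_restrictSet_eq hT K hKm]
  suffices h0 : hTr.restrictSet K hKm = 0 by rw [h0, Current.mass_zero]
  -- the basis, the projections, the a.e. vanishing
  set n := Module.finrank ℝ V with hn
  set b : Module.Basis (Fin n) ℝ V := Module.finBasis ℝ V with hb
  have hae : ∀ s : Set.powersetCard (Fin n) (m + 1), ∀ᵐ x ∂μ,
      K.indicator (1 : V → ℝ) x * hTr.polar hT x (pullbackDet (coordProj b s)) = 0 := by
    intro s
    set P := coordProj b s with hP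
    obtain ⟨Q, hPQ⟩ := exists_rightInverse_coordProj b s
    have hAc : IsCompact (P '' K) := hKc.image P.continuous
    have hA0 : volume (P '' K) = 0 := by
      have h1 : μH[((m : ℝ) + 1)] (P '' K) ≤ (‖P‖₊ : ℝ≥0∞) ^ ((m : ℝ) + 1) * μH[((m : ℝ) + 1)] K :=
        P.lipschitz.hausdorffMeasure_image_le (by positivity) K
      rw [hK0, mul_zero, nonpos_iff_eq_zero] at h1
      have h2 := MeasureTheory.hausdorffMeasure_pi_real (ι := Fin (m + 1))
      rw [Fintype.card_fin, Nat.cast_add, Nat.cast_one] at h2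
      rw [← h2]; exact h1
    filter_upwards [T.ae_indicator_preimage_mul_polar_eq_zero hT hdT hTc P Q hPQ hAc hA0] with x hx
    by_cases hxK : x ∈ K
    · have hPx : P x ∈ P '' K := mem_image_of_mem P hxK
      rw [indicator_of_mem hPx, Pi.one_apply, one_mul] at hx
      rw [hx, mul_zero]
    · rw [indicator_of_notMem hxK, zero_mul]
  -- conclusion: `(T ⌞ K)(φ) = 0` for every `φ`
  ext φ
  rw [hTr.restrictSet_apply, hTr.extend_eq_integral_polar hT, show (0 : Current (⊤ : Opens V) (m + 1)) φ = 0 from rfl]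
  have h1 : ∫ x, hTr.polar hT x ((((hTr.integrable_testForm φ).indicator hKm).toL1
      (K.indicator ⇑φ)) x) ∂μ = ∫ x, hTr.polar hT x (K.indicator ⇑φ x) ∂μ := by
    refine integral_congr_ae ?_
    filter_upwards [((hTr.integrable_testForm φ).indicator hKm).coeFn_toL1] with x hx
    rw [hx]
  rw [h1]
  -- expand `φ` in the basis covectors
  have hφ : ∀ x, K.indicator ⇑φ x = ∑ s : Set.powersetCard (Fin n) (m + 1),
      (K.indicator (1 : V → ℝ) x * φ x (fun i => b (Set.powersetCard.ofFinEmbEquiv.symm s i))) •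
        pullbackDet (coordProj b s) := by
    intro x
    by_cases hxK : x ∈ K
    · rw [indicator_of_mem hxK]
      ext v
      rw [ContinuousAlternatingMap.sum_apply, covector_apply_eq_sum b (φ x) v]
      refine Finset.sum_congr rfl fun s _ => ?_
      rw [ContinuousAlternatingMap.smul_apply, indicator_of_mem hxK, Pi.one_apply, one_mul, smul_eq_mul]
    · rw [indicator_of_notMem hxK]
      symm
      refine Finset.sum_eq_zero fun s _ => ?_
      rw [indicator_of_notMem hxK, zero_mul, zero_smul]
  simp_rw [hφ, map_sum, map_smul, smul_eq_mul]
  rw [integral_finsetSum _ fun s _ => ?_]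
  · refine Finset.sum_eq_zero fun s _ => integral_eq_zero_of_ae ?_
    filter_upwards [hae s] with x hx
    show K.indicator 1 x * (φ x) _ * hTr.polar hT x (pullbackDet (coordProj b s)) = (0 : ℝ)
    rw [mul_comm (K.indicator 1 x), mul_assoc, hx, mul_zero]
  · -- integrability of each summand: bounded measurable times integrable
    have hpol : StronglyMeasurable (hTr.polar hT) := hTr.stronglyMeasurable_polar hT
    have hKs : StronglyMeasurable fun x => hTr.polar hT x (pullbackDet (coordProj b s)) :=
      (ContinuousLinearMap.apply ℝ ℝ _).continuous.comp_stronglyMeasurable hpol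
    set v : Fin (m + 1) → V := fun i => b (Set.powersetCard.ofFinEmbEquiv.symm s i) with hv
    have hcoef : Continuous fun x => φ x v := (continuous_eval_const v).comp φ.contDiff.continuous
    have hcs : HasCompactSupport fun x => φ x v := by
      refine φ.hasCompactSupport.mono fun x hx => ?_
      rw [Function.mem_support] at hx ⊢
      intro h0
      exact hx (by rw [h0]; rfl)
    obtain ⟨C, hC⟩ := hcs.exists_bound_of_continuous hcoef
    refine Integrable.bdd_mul (hTr.integrable_polar_apply hT (integrable_const _))
      (((measurable_one.indicator hKm).aestronglyMeasurable).mul hcoef.aestronglyMeasurable)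
      (c := 1 * C) (Eventually.of_forall fun x => ?_)
    rw [norm_mul]
    refine mul_le_mul ?_ (hC x) (norm_nonneg _) zero_le_one
    by_cases hxK : x ∈ K
    · rw [indicator_of_mem hxK, Pi.one_apply, norm_one]
    · rw [indicator_of_notMem hxK, norm_zero]; exact zero_le_one

/-- **`‖T‖ ≪ 𝓗^{m+1}`** for `T` normal with compact support. [cite: Federer1969, 4.1.20, 4.1.21] -/
theorem Current.variation_absolutelyContinuous_hausdorffMeasure (T : Current (⊤ : Opens V) (m + 1))
    (hT : T.mass ≠ ⊤) (hdT : T.boundary.mass ≠ ⊤) (hTc : IsCompact T.support) :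
    T.variation ≪ μH[((m : ℝ) + 1)] := fun _ hE =>
  T.variation_eq_zero_of_hausdorffMeasure_eq_zero hT hdT hTc hE

/-- The same with Mathlib's Euclidean normalisation `μHE[m+1]` of Hausdorff measure.
[cite: Federer1969, 4.1.20, 4.1.21] -/
theorem Current.variation_eq_zero_of_euclideanHausdorffMeasure_eq_zero
    (T : Current (⊤ : Opens V) (m + 1)) (hT : T.mass ≠ ⊤) (hdT : T.boundary.mass ≠ ⊤)
    (hTc : IsCompact T.support) {E : Set V} (hE : (μHE[m + 1] : Measure V) E = 0) :
    T.variation E = 0 := by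
  refine T.variation_eq_zero_of_hausdorffMeasure_eq_zero hT hdT hTc ?_
  rw [Measure.euclideanHausdorffMeasure_def, Measure.coe_nnreal_smul_apply, mul_eq_zero,
    ENNReal.coe_eq_zero] at hE
  rcases hE with h | h
  · exact absurd h (Measure.addHaarScalarFactor_volume_hausdorffMeasure_ne_zero (m + 1))
  · simpa [Nat.cast_add, Nat.cast_one] using h

/-- **The upper density `Θ^{*(m+1)}(‖T‖, x)` is finite for `‖T‖`-a.e. `x`** when `T` is normal with
compact support: the set `{Θ^{*(m+1)}(‖T‖, ·) = ∞}` is `𝓗^{m+1}`-null by the density comparison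
theorem (Federer 2.10.19 (3)), hence `‖T‖`-null. [cite: Federer1969, 4.1.20, 2.10.19 (3)] -/
theorem Current.ae_upperDensity_lt_top (T : Current (⊤ : Opens V) (m + 1)) (hT : T.mass ≠ ⊤)
    (hdT : T.boundary.mass ≠ ⊤) (hTc : IsCompact T.support) :
    ∀ᵐ x ∂T.variation, upperDensity (m + 1) T.variation x < ⊤ := by
  set μ := T.variation with hμ
  haveI : IsFiniteMeasure μ := T.isFiniteMeasure_variation hT
  set B := {x | upperDensity (m + 1) μ x = ⊤} with hB
  have hB0 : μH[((m : ℝ) + 1)] B = 0 := by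
    by_contra hne
    set C := (8 : ℝ≥0∞) ^ (m + 1) * μ univ with hC
    have hCtop : C < ⊤ :=
      ENNReal.mul_lt_top (ENNReal.pow_lt_top (by simp)) (measure_lt_top μ univ)
    set a := unitBallVolume (m + 1) * μH[((m : ℝ) + 1)] B with ha
    have hle : ∀ n : ℕ, (n : ℝ≥0∞) * a ≤ C := by
      intro n
      have h := mul_hausdorffMeasure_le_of_lt_upperDensity μ (m + 1) isOpen_univ (subset_univ B)
        (t := n) fun x hx => by
          rw [show upperDensity (m + 1) μ x = ⊤ from hx]; exact ENNReal.natCast_lt_top n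
      rw [Nat.cast_add, Nat.cast_one, mul_assoc] at h
      exact h
    have ha0 : a ≠ 0 := mul_ne_zero (unitBallVolume_ne_zero _) hne
    rcases eq_or_ne a ⊤ with hat | hat
    · have h1 := hle 1
      rw [hat, Nat.cast_one, one_mul, top_le_iff] at h1
      exact hCtop.ne h1
    · obtain ⟨n, hn⟩ := ENNReal.exists_nat_gt (ENNReal.div_lt_top hCtop.ne ha0).ne
      have h2 : C < n * a := (ENNReal.div_lt_iff (Or.inl ha0) (Or.inl hat)).1 hn
      exact (lt_irrefl _) (h2.trans_le (hle n))
  have h := T.variation_eq_zero_of_hausdorffMeasure_eq_zero hT hdT hTc hB0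
  rw [ae_iff]
  simpa [not_lt, top_le_iff] using h

end Main

end Literature.Geometry.GeometricMeasureTheory
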